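import Summits.BirchSwinnertonDyer.BirchSwinnertonDyer.Theorems.ManinLocalTwoThreeIstarTwoNormalForm
import Literature.NumberTheory.DiophantineGeometry.ConductorExponentLeEightProofs
import HarnessLib

/-!
# The deep normal form of Kodaira type `Iₙ*` (`n ≥ 1`) with its exit witness, residue characteristic `2`
# (route `ManinLocalTwoThree`, crux C2 `ManinOddAtFour` stmt-BirchSwinnertonDyer-22967; S-an-63 «16 ∥ N descends», rows I₃*, I₄*, Iₙ≥₅*; p3 gen 12)

The tree's `exists_smul_of_kodairaSymbolOfMinimal_eq_Istar_succ` records only the ROUND-0 shape of an `Iₙ*` model, and the sibling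
`…IstarTwoNormalForm` unfolds one round by hand (`n = 2`).  Here the whole sub-procedure `istarIndexAux` of Step 7 is followed by
induction on its fuel (the skeleton of `addVal_Δ_toNat_le_istarIndexAux_add_eleven`): if it returns `n ≠ 0` from round `m` on a
round-`m` model, then after finitely many `u = 1` translations the model has the EXIT SHAPE of the round `k` at which it stopped —
`n = 2k + 1`: `π ∣ a₁`, `π ∥ a₂`, `π^{k+2} ∥ a₃`, `π^{k+3} ∣ a₄`, `π^{2k+4} ∣ a₆` (first test fires: in residue characteristic `2`
the quadratic `Y² + a₃,ₖ₊₂ Y − a₆,₂ₖ₊₄` is separable iff `a₃,ₖ₊₂ ≠ 0`), or `n = 2k + 2`: `π ∣ a₁`, `π ∥ a₂`, `π^{k+3} ∣ a₃`,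
`π^{k+3} ∥ a₄`, `π^{2k+5} ∣ a₆` (second test fires: `a₂,₁X² + a₄,ₖ₊₃X + a₆,₂ₖ₊₅` separable iff `a₄,ₖ₊₃ ≠ 0`)
(`exists_smul_of_istarIndexAux_ne_zero`).  Prefixed with Steps 2, 6 and the initial translation of Step 7 this gives the deep normal
form of any `V` with `kodairaSymbolOfMinimal V = Iₙ*`, `n ≥ 1` (`exists_smul_deep_of_kodairaSymbolOfMinimal_eq_Istar`).
With `2` a uniformiser, §2 adds: on these shapes `ord Δ = n + 8` — the `f = 4` stratum — forces `a₁/2 ∈ Rˣ` (`n ≥ 3`; the identities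
are those inside `addVal_Δ_toNat_le_of_istarA/B`, whose other cases give `ord Δ ∈ {12, n+10}` resp. `n + 10`).
HONEST FRAMING: Tate-algorithm bookkeeping; nothing about BSD or Manin's conjecture is proved; C2 OPEN.
[cite: SilvermanATAEC1994, IV.9.4 Step 7 (PDF pp. 345–346) and Table 4.1]
-/

set_option autoImplicit false
-- lint-debt: the directory name repeats the summit name (sibling precedent `ManinLocalTwoThreeNegOneTwistConductorAtTwo.lean`)
set_option linter.dupNamespace false

noncomputable section

open scoped Classical
open Polynomial IsLocalRing WeierstrassCurve
open IsDiscreteValuationRing hiding maximalIdeal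
open Literature.NumberTheory.DiophantineGeometry Literature.NumberTheory.DiophantineGeometry.TateAlgorithm
  Literature.NumberTheory.DiophantineGeometry.TateAlgorithm.CharTwo

namespace Summit.BirchSwinnertonDyer.BirchSwinnertonDyer.Theorems.ManinLocalTwoThree

section General

variable {R : Type*} [CommRing R] [IsDomain R] [IsDiscreteValuationRing R]

/-- **The exit shape of the `Iₙ*` sub-procedure** (residue characteristic `2`, perfect residue field).  If `istarIndexAux fuel m V ≠ 0`
on a round-`m` model `V` (`π ∣ a₁`, `π ∥ a₂`, `π^{m+2} ∣ a₃`, `π^{m+3} ∣ a₄`, `π^{2m+4} ∣ a₆`), then some `D • V` with `D.u = 1` has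
the exit shape of the round `k` where the value `2k + 1` resp. `2k + 2` was returned, including the exit witness `π^{k+3} ∤ a₃`
resp. `π^{k+4} ∤ a₄`. [cite: SilvermanATAEC1994, IV.9.4 Step 7 (PDF pp. 345–346)] -/
theorem exists_smul_of_istarIndexAux_ne_zero [PerfectField (ResidueField R)] (h2 : Irreducible (2 : R)) :
    ∀ (fuel m : ℕ) (V : WeierstrassCurve R), V.a₁ ∈ maximalIdeal R → V.a₂ ∈ maximalIdeal R →
      V.a₂ ∉ maximalIdeal R ^ 2 → V.a₃ ∈ maximalIdeal R ^ (m + 2) → V.a₄ ∈ maximalIdeal R ^ (m + 3) →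
      V.a₆ ∈ maximalIdeal R ^ (2 * m + 4) → istarIndexAux fuel m V ≠ 0 →
      ∃ D : VariableChange R, D.u = 1 ∧ (D • V).a₁ ∈ maximalIdeal R ∧ (D • V).a₂ ∈ maximalIdeal R ∧
        (D • V).a₂ ∉ maximalIdeal R ^ 2 ∧
        ((∃ k, istarIndexAux fuel m V = 2 * k + 1 ∧ (D • V).a₃ ∈ maximalIdeal R ^ (k + 2) ∧
            (D • V).a₃ ∉ maximalIdeal R ^ (k + 3) ∧ (D • V).a₄ ∈ maximalIdeal R ^ (k + 3) ∧
            (D • V).a₆ ∈ maximalIdeal R ^ (2 * k + 4)) ∨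
          (∃ k, istarIndexAux fuel m V = 2 * k + 2 ∧ (D • V).a₃ ∈ maximalIdeal R ^ (k + 3) ∧
            (D • V).a₄ ∈ maximalIdeal R ^ (k + 3) ∧ (D • V).a₄ ∉ maximalIdeal R ^ (k + 4) ∧
            (D • V).a₆ ∈ maximalIdeal R ^ (2 * k + 5))) := by
  classical
  intro fuel
  induction fuel with
  | zero => intro m V _ _ _ _ _ _ hne; exact absurd (istarIndexAux_zero m V) hne
  | succ f ih =>
    intro m V h1 h2' h2n h3 h4 h6 hne
    rw [istarIndexAux_succ] at hne ⊢
    dsimp only at hne ⊢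
    -- first test fires: exit `2m + 1`, witness `π^{m+3} ∤ a₃`
    by_cases hq1 : distinctRootCount (X ^ 2 + C (redCoeff V.a₃ (m + 2)) * X - C (redCoeff V.a₆ (2 * m + 4))) = 2
    · rw [if_pos hq1]
      have hne0 := ne_zero_of_distinctRootCount_monic_eq_two h2 hq1
      have h3n : ¬ uniformizer R ^ (m + 2 + 1) ∣ V.a₃ := fun h ↦
        hne0 ((redCoeff_eq_zero_iff (mem_maximalIdeal_pow_iff_dvd.mp h3)).mpr h)
      refine ⟨1, rfl, ?_⟩
      rw [one_smul]
      exact ⟨h1, h2', h2n, Or.inl ⟨m, rfl, h3, fun h ↦ h3n (mem_maximalIdeal_pow_iff_dvd.mp h), h4, h6⟩⟩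
    rw [if_neg hq1] at hne ⊢
    have hexA : ∃ C : VariableChange R, C.u = 1 ∧
        (C • V).a₁ ∈ maximalIdeal R ∧ (C • V).a₂ ∈ maximalIdeal R ∧
        (C • V).a₃ ∈ maximalIdeal R ^ (m + 3) ∧ (C • V).a₄ ∈ maximalIdeal R ^ (m + 3) ∧
        (C • V).a₆ ∈ maximalIdeal R ^ (2 * m + 5) :=
      exists_variableChange_istarA_of_perfectField h1 h2' h3 h4 h6 hq1
    rw [dif_pos hexA] at hne ⊢
    obtain ⟨hu1, hA₁, hA₂, hA₃, hA₄, hA₆⟩ := hexA.choose_spec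
    set V1 := hexA.choose • V with hV1
    have hA₂n : V1.a₂ ∉ maximalIdeal R ^ 2 :=
      OggBound.a₂_not_mem_sq_of_smul hu1 h1 h2' h2n (Ideal.pow_le_pow_right (by omega) h3)
        (Ideal.pow_le_pow_right (by omega) h4) (Ideal.pow_le_pow_right (by omega) h6) hA₁ hA₂
        (Ideal.pow_le_pow_right (by omega) hA₃) (Ideal.pow_le_pow_right (by omega) hA₄)
        (Ideal.pow_le_pow_right (by omega) hA₆)
    -- second test fires: exit `2m + 2`, witness `π^{m+4} ∤ a₄`
    by_cases hq2 : distinctRootCount (C (redCoeff V1.a₂ 1) * X ^ 2 + C (redCoeff V1.a₄ (m + 3)) * X +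
        C (redCoeff V1.a₆ (2 * m + 5))) = 2
    · rw [if_pos hq2]
      have ha2ne : redCoeff V1.a₂ 1 ≠ 0 := fun h ↦ hA₂n (mem_maximalIdeal_pow_iff_dvd.mpr
        ((redCoeff_eq_zero_iff (by rw [pow_one]; exact mem_maximalIdeal_iff_dvd.mp hA₂)).mp h))
      have hne0 := ne_zero_of_distinctRootCount_quadratic_eq_two h2 ha2ne hq2
      have h4n : ¬ uniformizer R ^ (m + 3 + 1) ∣ V1.a₄ := fun h ↦
        hne0 ((redCoeff_eq_zero_iff (mem_maximalIdeal_pow_iff_dvd.mp hA₄)).mpr h)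
      exact ⟨hexA.choose, hu1, hA₁, hA₂, hA₂n,
        Or.inr ⟨m, rfl, hA₃, hA₄, fun h ↦ h4n (mem_maximalIdeal_pow_iff_dvd.mp h), hA₆⟩⟩
    rw [if_neg hq2] at hne ⊢
    have hexB : ∃ C : VariableChange R, C.u = 1 ∧
        (C • V1).a₁ ∈ maximalIdeal R ∧ (C • V1).a₂ ∈ maximalIdeal R ∧
        (C • V1).a₃ ∈ maximalIdeal R ^ (m + 3) ∧ (C • V1).a₄ ∈ maximalIdeal R ^ (m + 4) ∧
        (C • V1).a₆ ∈ maximalIdeal R ^ (2 * m + 6) :=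
      exists_variableChange_istarB_of_perfectField hA₁ hA₂ hA₂n hA₃ hA₄ hA₆ hq2
    rw [dif_pos hexB] at hne ⊢
    obtain ⟨hu2, hB₁, hB₂, hB₃, hB₄, hB₆⟩ := hexB.choose_spec
    set V2 := hexB.choose • V1 with hV2
    have hB₂n : V2.a₂ ∉ maximalIdeal R ^ 2 :=
      OggBound.a₂_not_mem_sq_of_smul hu2 hA₁ hA₂ hA₂n (Ideal.pow_le_pow_right (by omega) hA₃)
        (Ideal.pow_le_pow_right (by omega) hA₄) (Ideal.pow_le_pow_right (by omega) hA₆) hB₁ hB₂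
        (Ideal.pow_le_pow_right (by omega) hB₃) (Ideal.pow_le_pow_right (by omega) hB₄)
        (Ideal.pow_le_pow_right (by omega) hB₆)
    obtain ⟨D, hDu, hD₁, hD₂, hD₂n, hD⟩ := ih (m + 1) V2 hB₁ hB₂ hB₂n hB₃ hB₄
      (by rw [show 2 * (m + 1) + 4 = 2 * m + 6 by ring]; exact hB₆) hne
    have hDV : (D * hexB.choose * hexA.choose) • V = D • V2 := by simp only [mul_smul, hV2, hV1]
    refine ⟨D * hexB.choose * hexA.choose, ?_, ?_⟩
    · simp only [VariableChange.mul_def]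
      rw [hDu, hu2, hu1]; norm_num
    · rw [hDV]; exact ⟨hD₁, hD₂, hD₂n, hD⟩

/-- **The deep normal form of type `Iₙ*`, `n ≥ 1`, with its exit witness** (residue characteristic `2`, perfect residue field): if Tate's
algorithm returns `Istar n` on `V`, `n ≠ 0`, then some `D • V` with `D.u = 1` has, for `n = 2k + 1`: `π ∣ a₁`, `π ∥ a₂`, `π^{k+2} ∥ a₃`,
`π^{k+3} ∣ a₄`, `π^{2k+4} ∣ a₆`; for `n = 2k + 2`: `π ∣ a₁`, `π ∥ a₂`, `π^{k+3} ∣ a₃`, `π^{k+3} ∥ a₄`, `π^{2k+5} ∣ a₆`.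
[cite: SilvermanATAEC1994, IV.9.4 Steps 2, 6, 7 (PDF pp. 344–346)] -/
theorem exists_smul_deep_of_kodairaSymbolOfMinimal_eq_Istar [PerfectField (ResidueField R)] (h2 : Irreducible (2 : R))
    (V : WeierstrassCurve R) {n : ℕ} (hV : V.kodairaSymbolOfMinimal = .Istar n) (hn : n ≠ 0) :
    ∃ D : VariableChange R, D.u = 1 ∧ (D • V).a₁ ∈ maximalIdeal R ∧ (D • V).a₂ ∈ maximalIdeal R ∧
      (D • V).a₂ ∉ maximalIdeal R ^ 2 ∧
      ((∃ k, n = 2 * k + 1 ∧ (D • V).a₃ ∈ maximalIdeal R ^ (k + 2) ∧ (D • V).a₃ ∉ maximalIdeal R ^ (k + 3) ∧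
          (D • V).a₄ ∈ maximalIdeal R ^ (k + 3) ∧ (D • V).a₆ ∈ maximalIdeal R ^ (2 * k + 4)) ∨
        (∃ k, n = 2 * k + 2 ∧ (D • V).a₃ ∈ maximalIdeal R ^ (k + 3) ∧ (D • V).a₄ ∈ maximalIdeal R ^ (k + 3) ∧
          (D • V).a₄ ∉ maximalIdeal R ^ (k + 4) ∧ (D • V).a₆ ∈ maximalIdeal R ^ (2 * k + 5))) := by
  classical
  obtain ⟨n, rfl⟩ := Nat.exists_eq_succ_of_ne_zero hn
  have hϖ : Irreducible (uniformizer R) := irreducible_uniformizer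
  set ϖ := uniformizer R with hϖdef
  have hV' := hV
  unfold WeierstrassCurve.kodairaSymbolOfMinimal at hV'
  obtain ⟨h1, h2', h3, h4, h5, h6, h7, hidx⟩ :=
    (tateTree_eq_Istar_succ_iff _ _ _ _ _ _ _ _ _ _ _ _ _).mp hV'
  rw [not_not] at h1 h2' h3 h4 h5
  -- Steps 2 and 6
  have hex2 := exists_variableChange_step2_of_perfectField V h1
  have hN2 : normalizeStep2 V = hex2.choose • V := dif_pos hex2
  obtain ⟨hu2, hA₃, hA₄, -⟩ := hex2.choose_spec
  rw [hN2] at h2' h3 h4 h5 h6 h7 hidx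
  have hex6 := exists_variableChange_step6_of_perfectField h2' hA₃ hA₄ h3 h5 h4
  have hN6 : normalizeStep6 (hex2.choose • V) = hex6.choose • (hex2.choose • V) := dif_pos hex6
  obtain ⟨hu6, hB₁, hB₂, hB₃, hB₄, hB₆⟩ := hex6.choose_spec
  rw [hN6] at h6 h7 hidx
  set W₆ := hex6.choose • (hex2.choose • V) with hW₆
  have q1 := mem_maximalIdeal_iff_dvd.mp hB₁
  have q2 := mem_maximalIdeal_iff_dvd.mp hB₂
  have q3 := mem_maximalIdeal_pow_iff_dvd.mp hB₃
  have q4 := mem_maximalIdeal_pow_iff_dvd.mp hB₄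
  have q6 := mem_maximalIdeal_pow_iff_dvd.mp hB₆
  -- Step 7: the algorithm's own round-0 model
  have hex7 := exists_variableChange_step7_of_dvd q1 q2 q3 q4 q6 h7
  have hidx' : istarIndex W₆ = n + 1 := hidx
  unfold istarIndex at hidx'
  rw [dif_pos hex7] at hidx'
  simp only [] at hidx'
  obtain ⟨hu7, m1, m2, m3, m4, m6⟩ := hex7.choose_spec
  set N₇ := hex7.choose • W₆ with hN₇
  have k1 := mem_maximalIdeal_iff_dvd.mp m1
  have k2 := mem_maximalIdeal_iff_dvd.mp m2
  have k3 := mem_maximalIdeal_pow_iff_dvd.mp m3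
  have k4 := mem_maximalIdeal_pow_iff_dvd.mp m4
  have k6 := mem_maximalIdeal_pow_iff_dvd.mp m6
  have k2n : ¬ ϖ ^ 2 ∣ N₇.a₂ := by
    obtain ⟨hr, hs, ht⟩ := dvd_r_s_t_of_step6 hu7 q1 q2 q3 q4 q6 k1 k2 k3 ((pow_dvd_pow ϖ (by norm_num)).trans k4)
      ((pow_dvd_pow ϖ (by norm_num)).trans k6)
    refine not_sq_dvd_a₂_of_distinctRootCount_eq_two k4 k6 ?_
    rw [distinctRootCount_cubicStep6_smul hu7 q1 q2 q3 q4 q6 hr hs ht]; exact h7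
  have m2n : N₇.a₂ ∉ maximalIdeal R ^ 2 := fun h ↦ k2n (mem_maximalIdeal_pow_iff_dvd.mp h)
  have hne : istarIndexAux (addVal R W₆.Δ).toNat 0 N₇ ≠ 0 := by rw [hidx']; exact Nat.succ_ne_zero n
  obtain ⟨D, hDu, hD₁, hD₂, hD₂n, hD⟩ := exists_smul_of_istarIndexAux_ne_zero h2 _ 0 N₇ m1 m2 m2n (by simpa using m3)
    (by simpa using m4) (by simpa using m6) hne
  rw [hidx'] at hD
  have hDV : (D * hex7.choose * hex6.choose * hex2.choose) • V = D • N₇ := by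
    simp only [mul_smul, hN₇, hW₆]
  refine ⟨D * hex7.choose * hex6.choose * hex2.choose, ?_, ?_⟩
  · simp only [VariableChange.mul_def]
    rw [hDu, hu7, hu6, hu2]; norm_num
  · rw [hDV]; exact ⟨hD₁, hD₂, hD₂n, hD⟩

end General

section TwoUniformizer

variable {R : Type*} [CommRing R] [IsDomain R] [IsDiscreteValuationRing R]

/-- **`ord Δ = n + 8` on the exit shape `n = 2k + 3` (first test of round `k + 1 ≥ 1`) forces `a₁/2 ∈ Rˣ`** (`2` a uniformiser): on
`[2α, 2p, 2^{k+3}γ, 2^{k+4}q, 2^{2k+6}r]` with `p, γ ∈ Rˣ`, if `2 ∣ α` then `ord Δ = 12` (`k = 0`) or `ord Δ = 2k + 13` (`k ≥ 1`) — the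
identities of `addVal_Δ_toNat_le_of_istarA` —, never `2k + 11`. [cite: SilvermanATAEC1994, IV.9.4 Step 7 and Table 4.1] -/
theorem isUnit_of_istarAForm_of_addVal (h2 : Irreducible (2 : R)) (V : WeierstrassCurve R) (k : ℕ) {α p γ q r : R}
    (hα : V.a₁ = 2 * α) (ha₂ : V.a₂ = 2 * p) (hp : IsUnit p) (ha₃ : V.a₃ = 2 ^ (k + 3) * γ) (hγ : IsUnit γ)
    (hq : V.a₄ = 2 ^ (k + 4) * q) (hr : V.a₆ = 2 ^ (2 * k + 6) * r) (hΔ : (addVal R V.Δ).toNat = 2 * k + 11) : IsUnit α := by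
  by_contra hαu
  obtain ⟨α₁, hα₁⟩ := (not_isUnit_iff_dvd h2 _).mp hαu
  rcases k with _ | k
  · have e : V.Δ = 2 ^ 12 * (γ ^ 4 + 2 *
        (-p ^ 3 * γ ^ 2 - 4 * p ^ 3 * r - 4 * p ^ 2 * γ ^ 2 * α₁ ^ 2 + 4 * p ^ 2 * γ * q * α₁
       + 2 * p ^ 2 * q ^ 2 - 24 * p ^ 2 * r * α₁ ^ 2 + 18 * p * γ ^ 3 * α₁
       + 18 * p * γ ^ 2 * q - 4 * p * γ ^ 2 * α₁ ^ 4 + 16 * p * γ * q * α₁ ^ 3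
       + 72 * p * γ * r * α₁ + 8 * p * q ^ 2 * α₁ ^ 2 + 72 * p * q * r - 48 * p * r * α₁ ^ 4
       - 14 * γ ^ 4 + 4 * γ ^ 3 * α₁ ^ 3 - 60 * γ ^ 2 * q * α₁ ^ 2 - 108 * γ ^ 2 * r
       - 96 * γ * q ^ 2 * α₁ + 16 * γ * q * α₁ ^ 5 + 144 * γ * r * α₁ ^ 3 - 32 * q ^ 3
       + 8 * q ^ 2 * α₁ ^ 4 + 144 * q * r * α₁ ^ 2 - 216 * r ^ 2 - 32 * r * α₁ ^ 6)) := by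
      simp only [WeierstrassCurve.Δ, WeierstrassCurve.b₂, WeierstrassCurve.b₄,
        WeierstrassCurve.b₆, WeierstrassCurve.b₈, hα, ha₂, ha₃, hq, hr, hα₁]
      ring
    rw [addVal_toNat_eq_of_two h2 (hγ.pow 4) e] at hΔ
    norm_num at hΔ
  · have e : V.Δ = 2 ^ (2 * k + 15) * (p ^ 3 * γ ^ 2 + 2 *
        (-p ^ 3 * γ ^ 2 - 2 * p ^ 3 * r - 2 * p ^ 2 * γ ^ 2 * α₁ ^ 2 + 2 * p ^ 2 * γ * q * α₁
       + p ^ 2 * q ^ 2 - 12 * p ^ 2 * r * α₁ ^ 2 + 18 * p * γ ^ 3 * (2 ^ k : R) * α₁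
       + 18 * p * γ ^ 2 * q * (2 ^ k : R) - 2 * p * γ ^ 2 * α₁ ^ 4 + 8 * p * γ * q * α₁ ^ 3
       + 72 * p * γ * r * (2 ^ k : R) * α₁ + 4 * p * q ^ 2 * α₁ ^ 2
       + 72 * p * q * r * (2 ^ k : R) - 24 * p * r * α₁ ^ 4 - 27 * γ ^ 4 * (2 ^ k : R) ^ 2
       + 4 * γ ^ 3 * (2 ^ k : R) * α₁ ^ 3 - 60 * γ ^ 2 * q * (2 ^ k : R) * α₁ ^ 2
       - 216 * γ ^ 2 * r * (2 ^ k : R) ^ 2 - 96 * γ * q ^ 2 * (2 ^ k : R) * α₁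
       + 8 * γ * q * α₁ ^ 5 + 144 * γ * r * (2 ^ k : R) * α₁ ^ 3 - 32 * q ^ 3 * (2 ^ k : R)
       + 4 * q ^ 2 * α₁ ^ 4 + 144 * q * r * (2 ^ k : R) * α₁ ^ 2
       - 432 * r ^ 2 * (2 ^ k : R) ^ 2 - 16 * r * α₁ ^ 6)) := by
      simp only [WeierstrassCurve.Δ, WeierstrassCurve.b₂, WeierstrassCurve.b₄,
        WeierstrassCurve.b₆, WeierstrassCurve.b₈, hα, ha₂, ha₃, hq, hr, hα₁]
      ring
    rw [addVal_toNat_eq_of_two h2 ((hp.pow 3).mul (hγ.pow 2)) e] at hΔ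
    omega

/-- **`ord Δ = n + 8` on the exit shape `n = 2m + 2` (second test of round `m`) forces `a₁/2 ∈ Rˣ`** (`2` a uniformiser): on
`[2α, 2p, 2^{m+3}γ, 2^{m+3}q, 2^{2m+5}r]`, if `2 ∣ α` then `2^{2m+12} ∣ Δ` (no unit hypothesis is needed for this direction). [cite: SilvermanATAEC1994, IV.9.4 Step 7 and Table 4.1] -/
theorem isUnit_of_istarBForm_of_addVal (h2 : Irreducible (2 : R)) (V : WeierstrassCurve R) (m : ℕ) {α p γ q r : R}
    (hα : V.a₁ = 2 * α) (ha₂ : V.a₂ = 2 * p) (hγ : V.a₃ = 2 ^ (m + 3) * γ)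
    (ha₄ : V.a₄ = 2 ^ (m + 3) * q) (hr : V.a₆ = 2 ^ (2 * m + 5) * r) (hΔ0 : V.Δ ≠ 0)
    (hΔ : (addVal R V.Δ).toNat = 2 * m + 10) : IsUnit α := by
  by_contra hαu
  obtain ⟨α₁, hα₁⟩ := (not_isUnit_iff_dvd h2 _).mp hαu
  have h12 : (2 : R) ^ (2 * m + 12) ∣ V.Δ := by
    have e : V.Δ = 2 ^ (2 * m + 12) * (-32 * α₁ ^ 6 * r + 16 * α₁ ^ 5 * γ * q - 8 * α₁ ^ 4 * p * γ ^ 2 - 48 * α₁ ^ 4 * p * r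
        + 4 * α₁ ^ 4 * q ^ 2 + 16 * α₁ ^ 3 * p * γ * q + 8 * α₁ ^ 3 * γ ^ 3 * (2 ^ m : R) + 144 * α₁ ^ 3 * γ * r * (2 ^ m : R)
        - 8 * α₁ ^ 2 * p ^ 2 * γ ^ 2 - 24 * α₁ ^ 2 * p ^ 2 * r + 4 * α₁ ^ 2 * p * q ^ 2 - 60 * α₁ ^ 2 * γ ^ 2 * q * (2 ^ m : R)
        + 72 * α₁ ^ 2 * q * r * (2 ^ m : R) + 4 * α₁ * p ^ 2 * γ * q + 36 * α₁ * p * γ ^ 3 * (2 ^ m : R)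
        + 72 * α₁ * p * γ * r * (2 ^ m : R) - 48 * α₁ * γ * q ^ 2 * (2 ^ m : R) - 2 * p ^ 3 * γ ^ 2 - 4 * p ^ 3 * r + p ^ 2 * q ^ 2
        + 18 * p * γ ^ 2 * q * (2 ^ m : R) + 36 * p * q * r * (2 ^ m : R) - 27 * γ ^ 4 * (2 ^ m : R) ^ 2
        - 108 * γ ^ 2 * r * (2 ^ m : R) ^ 2 - 8 * q ^ 3 * (2 ^ m : R) - 108 * r ^ 2 * (2 ^ m : R) ^ 2) := by
      simp only [WeierstrassCurve.Δ, WeierstrassCurve.b₂, WeierstrassCurve.b₄,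
        WeierstrassCurve.b₆, WeierstrassCurve.b₈, hα, ha₂, hγ, ha₄, hr, hα₁]
      ring
    exact ⟨_, e⟩
  have := le_addVal_toNat_of_pow_dvd h2 hΔ0 h12
  omega

end TwoUniformizer

end Summit.BirchSwinnertonDyer.BirchSwinnertonDyer.Theorems.ManinLocalTwoThree

end
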